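import Summits.Ventures.PercRepro.RankLevelSetLevelSixHeavyCellSq27DI
import Summits.Ventures.PercRepro.RankLevelSetLevelSixCapGlue25
import Summits.Ventures.PercRepro.TriangleCapEightI
import Summits.Ventures.PercRepro.S1TrianglePlusSharp
import Summits.Ventures.PercRepro.S1SeriesLever14
import Summits.Ventures.PercRepro.RankLevelSetLevelSixArithHeavySq24DFA

/-!
# PercRepro — THE 24 ROW, THE COLOOP-FREE CELLS `(p ≥ 24, d = 11, 12)` (p8 g10, S3)

`proofs/SUBCLAIM-S3-p8.md` §3x. The corrected cell `sq27di` with the per-corank parameters of ArithHeavySq24DFA and the coloop-free caps (`s3_cf_of` / `s4_cf_of` / `s5_cf_of` at `n₀ = 24 + d`): ratios `0.948 / 0.984`. Axioms: standard.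
-/

open scoped Matroid

namespace PercRepro

namespace ThmN

open Set

variable {α : Type}

/-- **The COLOOP-FREE `e`-free core at level `6`, corank `d = 11, 12`, rank `p ≥ 24`.** -/
theorem c025_core_six_basis_sq24_free (M : Matroid α) [M.Finite] (p d : ℕ) (hp : 24 ≤ p) (hd11 : 11 ≤ d) (hd12 : d ≤ 12) (hcf : ∀ e ∈ M.E, ¬ M.IsColoop e)
    (hR : M.eRank = (p : ℕ∞)) (hn : M.E.ncard = p + d)
    (hfree : ∀ e ∈ M.E, ∃ A ⊆ M.E \ {e}, e ∉ M.closure A ∧ e ∉ M.closure ((M.E \ {e}) \ A)) :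
    RLS M p 6 := by
  have hd : M.E.encard = M.eRank + d := by
    rw [hR, ← M.ground_finite.cast_ncard_eq, hn]
    push_cast
    ring
  have hL : ∀ e ∈ M.E, ¬ M.IsLoop e := not_isLoop_of_free M hfree
  have hs : ∀ e ∈ M.E, ∀ f ∈ M.E, e ≠ f → M.eRk {e, f} = 2 := by
    intro e he f hf hef
    have h2 : (2 : ℕ∞) ≤ M.eRk {e, f} :=
      two_le_eRk_of_two_le_ncard_of_free M hfree (pair_subset he hf) (by rw [ncard_pair hef])
    have h3 : M.eRk {e, f} ≤ 2 := by
      have := M.eRk_le_encard {e, f}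
      rwa [encard_pair hef] at this
    exact le_antisymm h3 h2
  have hC1 : ∀ L ⊆ M.E, M.eRk L = 2 → L.ncard ≤ 3 :=
    fun L hL hr => ncard_le_three_of_eRk_two M hs hfree hL hr
  have hC2 : ∀ P ⊆ M.E, M.eRk P ≤ 3 → P.ncard ≤ 6 :=
    fun P hP hr => ncard_le_six_of_eRk_le_three_of_free M hfree hP hr
  have hΦ : phiK p 6 ≤ (2 : ℚ) ^ (p + 6) / (((p + 6).choose 6 : ℕ) : ℚ) := phiK_le_two_pow_div_six p
  rw [RLS_iff]
  interval_cases d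
  · exact c025_core_six_heavy_cell_sq27di M p 11 9 1 1 19 16 0 45157 1000 17 1592 188 21
      ((p + 6).choose 6) (Nat.choose_pos (by omega)) (phiK p 6) hΦ (by norm_num) (by omega)
      (by norm_num) (by norm_num) (by norm_num) (by norm_num) (by norm_num)
      (by norm_num [cnull]) (by norm_num [cnull]) (Or.inl (by norm_num)) (Or.inr (Or.inl ⟨by norm_num, by norm_num⟩)) (Or.inl (by norm_num)) (by norm_num) (by norm_num) (by norm_num)
      (s3_cf_of M hfree hcf (d := 10) (by simpa using hd) 35 21 (by norm_num) (by omega) (by norm_num [TriangleCap.cq3]) (by norm_num [TriangleCap.cq3]) (by norm_num [TriangleCap.cq3]))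
      (s4_cf_of M hfree hcf (d := 10) (by rw [hd]; norm_num) 35 167 188 (by norm_num) (by omega) (by decide) (by omega))
      (s5_cf_of M hfree hcf (d := 10) (by rw [hd]; norm_num) 35 1365 1592 (by norm_num) (by omega) (by decide) (by omega))
      (Or.inl (tail_six_heavy_sq24DF_11 p hp)) hR hn hfree (level_six_poly_heavy_sq24DF_11 p hp)
  · exact c025_core_six_heavy_cell_sq27di M p 12 10 1 1 20 17 0 29438 1000 18 2305 249 26
      ((p + 6).choose 6) (Nat.choose_pos (by omega)) (phiK p 6) hΦ (by norm_num) (by omega)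
      (by norm_num) (by norm_num) (by norm_num) (by norm_num) (by norm_num)
      (by norm_num [cnull]) (by norm_num [cnull]) (Or.inl (by norm_num)) (Or.inr (Or.inl ⟨by norm_num, by norm_num⟩)) (Or.inl (by norm_num)) (by norm_num) (by norm_num) (by norm_num)
      (s3_cf_of M hfree hcf (d := 11) (by simpa using hd) 36 26 (by norm_num) (by omega) (by norm_num [TriangleCap.cq3]) (by norm_num [TriangleCap.cq3]) (by norm_num [TriangleCap.cq3]))
      (s4_cf_of M hfree hcf (d := 11) (by rw [hd]; norm_num) 36 222 249 (by norm_num) (by omega) (by decide) (by omega))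
      (s5_cf_of M hfree hcf (d := 11) (by rw [hd]; norm_num) 36 1985 2305 (by norm_num) (by omega) (by decide) (by omega))
      (Or.inl (tail_six_heavy_sq24DF_12 p hp)) hR hn hfree (level_six_poly_heavy_sq24DF_12 p hp)

end ThmN

end PercRepro
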